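import Mathlib
import Literature.AlgebraicGeometry.Resolution.FlatLocalRegularAscentSeparable
import Literature.AlgebraicGeometry.Resolution.OrderFlatLocalHom

/-!
# KFibre — the fibres of the scalar extension `B → B ⊗_k K` are FIELDS for `K/k` separable algebraic
# (Layer C3/D3 of the tower dictionary: `𝔪_B B̃ = 𝔪_{B̃}` and unramifiedness at every prime)

0-weight TOOL toward `TightDefectClasses.TowerDictionary` (decomp-res lens-5, g39; plan `NEXT-g40.md` §2 C3 / §3 D3).  Pure commutative
algebra (imports `Mathlib` + two PROVED Literature files, reused by name).  Setting: fields `k ⊆ K` with `K/k` SEPARABLE ALGEBRAIC (e.g. `K = k̄` for `k` perfect), a commutative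
`k`-algebra `B` (in the dictionary: `B_i ≅ 𝒪_{X_i,x_i}`), `E = B ⊗_k K` (in the dictionary: `K·B_i ⊆ L′`, by `LinDisjoint`).

* (reused BY NAME from `Literature/AlgebraicGeometry/Resolution/FlatLocalRegularAscentSeparable`: `isReduced_tensorProduct_of_isSeparable'`
  — EGA IV₂ (4.3.5), `L ⊗_k K` reduced — and `isReduced_tensorProduct_of_isSeparable_of_isDomain` — EGA IV₂ (4.6.1).)  This is exactly where
  perfectness of the ground field enters the dictionary (cf. the catalogued barrier `Literature.Barriers.ResolutionOfSingularities.
  InseparableBaseChange`: for `K/k` inseparable `K ⊗_k K` is not reduced and the statements below fail).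
* `isReduced_quotient_map` — `E/𝔓E ≅ (B/𝔓) ⊗_k K` is reduced for every prime `𝔓` of `B`.
* **`map_comap_eq_maximalIdeal`** — for every prime `𝔮` of `E = B ⊗_k K` with contraction `𝔓 = 𝔮 ∩ B`:
  `𝔓 · E_𝔮 = 𝔮 E_𝔮` — the local ring of the fibre `E_𝔮 / 𝔓 E_𝔮` is a field.  (Incomparability for the integral extension `B → E` makes `𝔮` the
  only prime of `E_𝔮` over `𝔓 E_𝔮`; the quotient `E_𝔮/𝔓E_𝔮` is a localisation of `(B/𝔓) ⊗_k K ⊆ κ(𝔓) ⊗_k K`, reduced by the first point; a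
  reduced local ring with one prime is a field.)
* **`algebraMap_mem_pow_maximalIdeal_iff`** — ORDER TRANSPORT along `B_𝔓 → E_𝔮` (flat local, `𝔓 E_𝔮 = 𝔮 E_𝔮`, hence faithfully flat and
  `Literature…OrderFlatLocalHom.mem_pow_maximalIdeal_iff_of_map_maximalIdeal_eq` applies): for `b ∈ B`, `b ∈ 𝔓^n B_𝔓 ↔ b ∈ 𝔮^n E_𝔮` — i.e.
  `𝔮^(n) ∩ B = 𝔓^(n)` (symbolic powers).  Used twice downstream: at the closed point (`ord_{x_i}` read in `B̃_i`, Layers C3/D1, feeding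
  `FrameStep.frame_step`'s certificate hypothesis `hfg` and its equimultiplicity clause) and at the generization `𝔔̃` of the isolation transport
  (Layer D3, with `IsoDict.exists_prime_of_not_isolatedTop` / `IsoDict.hypZ_mem_symbPow` on the `K`-side and
  `ShallowPort.exists_specializes_ne_le_idealOrder` + `SurfacePort.tower_exists_isolating_open` on the tower side).

All PROVED, 0 sorry.  Sources: [EGAIV2, Prop. (4.3.5), (4.6.1)], [Matsumura1987, Thm. 9.3 (incomparability), Thm. 7.5 (faithful flatness:
`IB ∩ A = I`, here for `I = 𝔪ⁿ` along a flat local homomorphism with trivial closed fibre)] — folklore.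
-/

noncomputable section

set_option linter.dupNamespace false

namespace Summit.ResolutionOfSingularities.ResolutionOfSingularities.Theorems.KFibre

open TensorProduct IsLocalRing Literature.AlgebraicGeometry.Resolution

variable (k K : Type) [Field k] [Field K] [Algebra k K] [Algebra.IsSeparable k K]

/-! ## §1 The fibres of `B → B ⊗_k K` are fields -/

variable (B : Type) [CommRing B] [Algebra k B]

/-- `E/𝔓E ≅ (B/𝔓) ⊗_k K` is reduced, `E = B ⊗_k K`. -/
theorem isReduced_quotient_map (𝔓 : Ideal B) [𝔓.IsPrime] :
    IsReduced ((B ⊗[k] K) ⧸ 𝔓.map (algebraMap B (B ⊗[k] K))) := by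
  haveI := isReduced_tensorProduct_of_isSeparable_of_isDomain k K (B ⧸ 𝔓)
  exact isReduced_of_injective _ (Algebra.TensorProduct.quotientTensorEquiv (R := k) k K B 𝔓).symm.injective

/-- **THE FIBRES OF THE SCALAR EXTENSION ARE FIELDS.**  `K/k` separable algebraic, `B` a commutative `k`-algebra, `𝔮` a prime of
`E = B ⊗_k K` with contraction `𝔓 = 𝔮 ∩ B`.  Then `𝔓 E_𝔮 = 𝔮 E_𝔮`: the maximal ideal of `E_𝔮` is generated by `𝔓`.
[cite: EGAIV2, Prop. (4.6.1)] [cite: Matsumura1987, Thm. 9.3] -/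
theorem map_comap_eq_maximalIdeal (𝔮 : Ideal (B ⊗[k] K)) [𝔮.IsPrime] :
    (𝔮.comap (algebraMap B (B ⊗[k] K))).map (algebraMap B (Localization.AtPrime 𝔮)) =
      maximalIdeal (Localization.AtPrime 𝔮) := by
  haveI h𝔓p : (𝔮.comap (algebraMap B (B ⊗[k] K))).IsPrime := Ideal.comap_isPrime _ 𝔮
  have hIE : (𝔮.comap (algebraMap B (B ⊗[k] K))).map (algebraMap B (Localization.AtPrime 𝔮)) =
      ((𝔮.comap (algebraMap B (B ⊗[k] K))).map (algebraMap B (B ⊗[k] K))).map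
        (algebraMap (B ⊗[k] K) (Localization.AtPrime 𝔮)) := by
    rw [Ideal.map_map, ← IsScalarTower.algebraMap_eq]
  -- `𝔓 L ⊆ 𝔪_L`
  have h1 : (𝔮.comap (algebraMap B (B ⊗[k] K))).map (algebraMap B (Localization.AtPrime 𝔮)) ≤
      maximalIdeal (Localization.AtPrime 𝔮) := by
    rw [hIE, ← Localization.AtPrime.map_eq_maximalIdeal]
    exact Ideal.map_mono (Ideal.map_le_iff_le_comap.mpr le_rfl)
  -- integrality of `B → E`
  haveI : Algebra.IsIntegral k K := Algebra.isAlgebraic_iff_isIntegral.mp inferInstance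
  haveI : Algebra.IsIntegral B (B ⊗[k] K) := Algebra.IsIntegral.tensorProduct k B K
  -- every prime of `L = E_𝔮` over `𝔓 L` is the maximal ideal (incomparability)
  have key : ∀ P'' : Ideal (Localization.AtPrime 𝔮), P''.IsPrime →
      (𝔮.comap (algebraMap B (B ⊗[k] K))).map (algebraMap B (Localization.AtPrime 𝔮)) ≤ P'' →
      maximalIdeal (Localization.AtPrime 𝔮) ≤ P'' := by
    intro P'' hP'' hIP
    haveI : (P''.comap (algebraMap (B ⊗[k] K) (Localization.AtPrime 𝔮))).IsPrime := Ideal.comap_isPrime _ P''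
    have hPq : P''.comap (algebraMap (B ⊗[k] K) (Localization.AtPrime 𝔮)) ≤ 𝔮 := by
      intro x hx
      rw [Ideal.mem_comap] at hx
      exact (IsLocalization.AtPrime.to_map_mem_maximal_iff (Localization.AtPrime 𝔮) 𝔮 x).mp
        (IsLocalRing.le_maximalIdeal hP''.ne_top hx)
    have hcomap : (P''.comap (algebraMap (B ⊗[k] K) (Localization.AtPrime 𝔮))).comap (algebraMap B (B ⊗[k] K)) =
        𝔮.comap (algebraMap B (B ⊗[k] K)) := by
      refine le_antisymm (Ideal.comap_mono hPq) ?_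
      intro b hb
      rw [Ideal.mem_comap, Ideal.mem_comap, ← IsScalarTower.algebraMap_apply]
      exact hIP (Ideal.mem_map_of_mem _ hb)
    have hPeq : P''.comap (algebraMap (B ⊗[k] K) (Localization.AtPrime 𝔮)) = 𝔮 := by
      by_contra hne
      have hlt : P''.comap (algebraMap (B ⊗[k] K) (Localization.AtPrime 𝔮)) < 𝔮 := lt_of_le_of_ne hPq hne
      have h := Ideal.IsIntegral.comap_lt_comap (R := B) hlt
      exact (ne_of_lt h) hcomap
    rw [← Localization.AtPrime.map_eq_maximalIdeal, Ideal.map_le_iff_le_comap, hPeq]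
  -- `𝔓 L` is radical: `L/𝔓L` is a localisation of the reduced ring `E/𝔓E`
  have hrad : ((𝔮.comap (algebraMap B (B ⊗[k] K))).map (algebraMap B (Localization.AtPrime 𝔮))).IsRadical := by
    rw [Ideal.isRadical_iff_quotient_reduced, hIE]
    haveI := isReduced_quotient_map k K B (𝔮.comap (algebraMap B (B ⊗[k] K)))
    exact isReduced_localizationPreserves
      (Algebra.algebraMapSubmonoid ((B ⊗[k] K) ⧸ (𝔮.comap (algebraMap B (B ⊗[k] K))).map (algebraMap B (B ⊗[k] K)))
        𝔮.primeCompl)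
      (Localization.AtPrime 𝔮 ⧸ ((𝔮.comap (algebraMap B (B ⊗[k] K))).map (algebraMap B (B ⊗[k] K))).map
        (algebraMap (B ⊗[k] K) (Localization.AtPrime 𝔮)))
      inferInstance
  -- conclude
  refine le_antisymm h1 ?_
  calc maximalIdeal (Localization.AtPrime 𝔮)
        ≤ ((𝔮.comap (algebraMap B (B ⊗[k] K))).map (algebraMap B (Localization.AtPrime 𝔮))).radical := by
        rw [Ideal.radical_eq_sInf]
        exact le_sInf fun J ⟨hIJ, hJ⟩ => key J hJ hIJ
    _ = (𝔮.comap (algebraMap B (B ⊗[k] K))).map (algebraMap B (Localization.AtPrime 𝔮)) := hrad.radical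

/-! ## §2 Order transport along `B_𝔓 → E_𝔮` -/

/-- **ORDER TRANSPORT.**  `K/k` separable algebraic, `B` a commutative `k`-algebra, `𝔮` a prime of `E = B ⊗_k K`, `𝔓 = 𝔮 ∩ B`.  For every
`b ∈ B` and `n`:  `b ∈ (𝔓 B_𝔓)^n ↔ b ∈ (𝔮 E_𝔮)^n` — the local homomorphism `B_𝔓 → E_𝔮` is flat with trivial closed fibre
(`map_comap_eq_maximalIdeal`), hence faithfully flat, and `𝔪ⁿ E_𝔮 ∩ B_𝔓 = 𝔪ⁿ`.  Equivalently `𝔮^(n) ∩ B = 𝔓^(n)` for the symbolic powers.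
[cite: Matsumura1987, Thm. 7.5, Thm. 9.3] -/
theorem algebraMap_mem_pow_maximalIdeal_iff (𝔮 : Ideal (B ⊗[k] K)) [𝔮.IsPrime] (n : ℕ) (b : B) :
    algebraMap B (Localization.AtPrime (𝔮.comap (algebraMap B (B ⊗[k] K)))) b ∈
        maximalIdeal (Localization.AtPrime (𝔮.comap (algebraMap B (B ⊗[k] K)))) ^ n ↔
      algebraMap B (Localization.AtPrime 𝔮) b ∈ maximalIdeal (Localization.AtPrime 𝔮) ^ n := by
  -- the local homomorphism `f : B_𝔓 → E_𝔮`
  let f := Localization.localRingHom (𝔮.comap (algebraMap B (B ⊗[k] K))) 𝔮 (algebraMap B (B ⊗[k] K)) rfl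
  have hflat : (algebraMap B (B ⊗[k] K)).Flat := RingHom.flat_algebraMap_iff.mpr inferInstance
  have hf : f.Flat := hflat.localRingHom 𝔮 (𝔮.comap (algebraMap B (B ⊗[k] K))) rfl
  have hfb : ∀ b : B, f (algebraMap B _ b) = algebraMap B (Localization.AtPrime 𝔮) b := by
    intro b
    rw [Localization.localRingHom_to_map, ← IsScalarTower.algebraMap_apply]
  letI := f.toAlgebra
  haveI : Module.Flat (Localization.AtPrime (𝔮.comap (algebraMap B (B ⊗[k] K)))) (Localization.AtPrime 𝔮) := hf
  haveI : IsLocalHom (algebraMap (Localization.AtPrime (𝔮.comap (algebraMap B (B ⊗[k] K)))) (Localization.AtPrime 𝔮)) :=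
    Localization.isLocalHom_localRingHom _ _ _ _
  haveI : Module.FaithfullyFlat (Localization.AtPrime (𝔮.comap (algebraMap B (B ⊗[k] K)))) (Localization.AtPrime 𝔮) :=
    Module.FaithfullyFlat.of_flat_of_isLocalHom
  have hmax : (maximalIdeal (Localization.AtPrime (𝔮.comap (algebraMap B (B ⊗[k] K))))).map
      (algebraMap (Localization.AtPrime (𝔮.comap (algebraMap B (B ⊗[k] K)))) (Localization.AtPrime 𝔮)) =
      maximalIdeal (Localization.AtPrime 𝔮) := by
    rw [← Localization.AtPrime.map_eq_maximalIdeal, Ideal.map_map, ← map_comap_eq_maximalIdeal k K B 𝔮]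
    congr 1
    ext b
    exact hfb b
  have key := mem_pow_maximalIdeal_iff_of_map_maximalIdeal_eq hmax n
    (algebraMap B (Localization.AtPrime (𝔮.comap (algebraMap B (B ⊗[k] K)))) b)
  rw [key]
  exact Iff.of_eq (congrArg (· ∈ _) (hfb b))

end Summit.ResolutionOfSingularities.ResolutionOfSingularities.Theorems.KFibre
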